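import Summits.QuantumFields.BalabanUV.Beta.EriceFlowEnclosureB12AsPrintedHistoryContagionShiftFlowPicardOpenEnd
import Summits.QuantumFields.BalabanUV.Beta.EriceFlowEnclosureB12AsPrintedHistoryContagionShiftFlowPicardFunctional

/-!
# Beta / EriceFlowEnclosureB12AsPrintedHistoryContagionShiftFlowPicardOpenLipschitz — ASYMPTOTIC FREEDOM IS CONTAGIOUS, part 22: THE SOLUTION OPERATOR IS LIPSCHITZ ON
# THE OPEN BALL.  Part 19 made the class of well-posed functionals open (every B′ with a memory profile within η < β*∕4 of a functional B admitting an AF solution has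
# its own AF box solutions near zero pin); part 16 made the solution Lipschitz in the functional given the quarter profiles.  Together: on the sup-norm ball of radius
# η₀ (4η₀ < β*) around B, intersected with the profile class, **the map B′ ↦ (ANY box solution of B′'s flow from a small pin e) is LIPSCHITZ, `|h′(m) − h″(m)| ≤
# (32∕3)e(e² + 1∕β₁)·sup|B′ − B″|` with β₁ = (β* − 4η₀)∕4, UNIFORMLY IN THE SCALE** — each perturbed functional's own AF solution from a fixed reference pin g₁ (part 19)
# serving as ITS reference for part 10's contagion, and part 16's functional law closing; node U2's `memFlow_stability` (joint Lipschitz dependence, there under the floor)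
# floor-free on an OPEN set of functionals none of which (except B) is asked for a reference.  On the carrier (§28): around `betaInf S.β` of ONE Setting with Theorem 2 AS
# TYPED (β-flow team, prover 1, unit `b2b-balaban-beta-bflow-p1`, gen 37; ROW AP-I·Uc × NODE U2)

HONEST FRAMING (page 1 of everything the β sub-cell writes): discharging `BetaPertH` makes Bałaban's UV stability UNCONDITIONAL — a
real constructive-QFT result; it is NOT the continuum limit and NOT the Clay problem.  HONEST DEPENDENCY (cell reorg 2026-08-19,
verbatim): «continuum YM on T⁴ ⇐ BetaPertH ∧ nine spine estimates (0/9 proved); BetaPertH ⇐ (D1) ∧ (D4) ∧ CAP+tail; G-an2-4 gates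
asym, D1 and NE2/3/4.»  THIS MODULE DISCHARGES NOTHING: a junction BY NAME of part 19 (`exists_memFlow_of_close`), part 16 (`abs_sub_le_of_functional_close`), part 10
(`invSq_lower_of_reference_flow`) and, on the carrier, part 15 (`reference_of_typedTheorem2`) and part 11 (`flow_threshold_exists`),
over node U2's HYPOTHESIS SHAPES `T4BetaStationary.{SeqBox, MemoryProfile}`, `T4BetaFlowWellPosed.MemFlow` and the NAMED FIELDS of `B12BetaAsPrinted` ([I] = T. Bałaban, Commun.
Math. Phys. **109** (1987) [Balaban1987RG1]; `Theorem2Statement` STATED WITHOUT PROOF, p. 259 — a HYPOTHESIS; NE4 ∕ moduli LETTERS NOT PRINTED, GAPS G-t4-U2-1 ∕ -2).  The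
nearby functionals are abstract HYPOTHESISED objects; nothing of Bałaban's β is asserted; nothing of node U2's modules is restated or modified.

WHAT THIS FILE PROVES (0 sorry, 0 def): §27 **`abs_sub_le_on_ball`** (two functionals B′, B″ in the η₀-ball around B, ANY box solutions of their flows from a pin e below the
perturbed threshold: `|h′(m) − h″(m)| ≤ (32∕3)e(e² + 1∕β₁)·δ` whenever `|B′ − B″| ≤ δ` on the box, β₁ = (β* − 4η₀)∕4); §28 **`solution_lipschitz_on_ball_of_typedTheorem2`** (carrier: ∀ m ∃ η₀, g₁₆ > 0, K: any two functionals
with profile (C, θ) within η₀ of `betaInf S.β` on ]0, γ_u], δ-close to each other, and any box solutions of their flows from a pin g ≤ g₁₆ are `≤ K·δ` apart at every scale).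
NOT CLAIMED: anything about Bałaban's β; `BetaPertH`; the continuum limit of the measures; Clay.
-/

namespace Summit.QuantumFields.BalabanUV.Beta.EriceFlowEnclosureB12AsPrintedHistoryContagionShiftFlowPicardOpenLipschitz

open Finset Filter Topology
open Literature.MathematicalPhysics.QuantumFieldTheory.Balaban1983to89
open Literature.MathematicalPhysics.QuantumFieldTheory.Balaban1983to89.B12BetaAsPrinted
open Literature.MathematicalPhysics.QuantumFieldTheory.Balaban1983to89.FlowStep (RGEqH)
open Literature.MathematicalPhysics.QuantumFieldTheory.Balaban1983to89.T4CouplingMatching (HistLipschitz FadingMemory ScaleShiftRate)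
open Literature.MathematicalPhysics.QuantumFieldTheory.Balaban1983to89.T4BetaStationary (SeqBox MemoryProfile betaInf memoryProfile_betaInf)
open Literature.MathematicalPhysics.QuantumFieldTheory.Balaban1983to89.T4BetaFlowWellPosed (MemFlow)
open Summit.QuantumFields.BalabanUV.Beta.EriceFlowEnclosureB12AsPrintedHistoryContagionShiftFlow (invSq_lower_of_reference_flow)
open Summit.QuantumFields.BalabanUV.Beta.EriceFlowEnclosureB12AsPrintedHistoryContagionShiftFlowEnd (flow_threshold_exists)
open Summit.QuantumFields.BalabanUV.Beta.EriceFlowEnclosureB12AsPrintedHistoryContagionShiftFlowPicardEnd (reference_of_typedTheorem2)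
open Summit.QuantumFields.BalabanUV.Beta.EriceFlowEnclosureB12AsPrintedHistoryContagionShiftFlowPicardFunctional (abs_sub_le_of_functional_close)
open Summit.QuantumFields.BalabanUV.Beta.EriceFlowEnclosureB12AsPrintedHistoryContagionShiftFlowPicardOpen (exists_memFlow_of_close)

noncomputable section

/-! ## §27 Two functionals in the ball: any two box solutions are Lipschitz-close -/

/-- **THE SOLUTION OPERATOR IS LIPSCHITZ ON THE OPEN BALL.**  `B` with memory profile `(C_m, θ)` on ]0, γ]^ℕ and ONE AF reference (t from g*, rate β*, pin t_a); a radius η₀ with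
`4η₀ < β*`, β₁ := (β* − 4η₀)∕4; two functionals B′, B″ with memory profile `(C_m, θ)`, both within η₀ of B on the box, `|B′ u − B″ u| ≤ δ` for all box u; a REFERENCE PIN g₁
(`0 < g₁`, `2g₁ ≤ γ`) below B's threshold (`4C_m g₁ ≤ β*(1−θ)`, `g₁²Q(g*, β*) ≤ 3∕4`, `64C_m g₁³ ≤ (1−θ)²`) and a pin `0 < e` below the PERTURBED threshold (`4C_m e ≤
β₁(1−θ)`, `e²Q(g₁, β₁) ≤ 3∕4`, `C_m(8e³ + 16e∕β₁) ≤ (1−θ)²∕4`); ANY box solutions h′ of `MemFlow B′ e ·`, h″ of `MemFlow B″ e ·`.  THEN at every scale m: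
**`|h′(m) − h″(m)| ≤ (32∕3)·e·(e² + 1∕β₁)·δ`** — part 19 gives B′, B″ their own AF solutions from g₁ (rate 4β₁·¼… i.e. profile `1∕(4g₁²) + β₁m`), part 10's contagion with THOSE as
references gives h′, h″ the quarter profile from 2e at rate β₁, part 16 closes. [cite: Balaban1987RG1, Thm 2 (0.31) p.259 with (0.20) p.256 and p.298] -/
theorem abs_sub_le_on_ball {B B' B'' : (ℕ → ℝ) → ℝ} {Cm θ γ bs ta gs g₁ e η₀ δ : ℝ} {t h' h'' : ℕ → ℝ}
    (hB : MemoryProfile Cm θ γ B) (hB' : MemoryProfile Cm θ γ B') (hB'' : MemoryProfile Cm θ γ B'')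
    (hCm : 0 ≤ Cm) (hθ0 : 0 ≤ θ) (hθ1 : θ < 1) (hbs : 0 < bs) (hta : 0 < ta)
    (hts : SeqBox γ t) (htf : MemFlow B gs t) (hprof : ∀ m : ℕ, 1 / ta ^ 2 + bs * (m : ℝ) ≤ 1 / (t m) ^ 2)
    (hη4 : 4 * η₀ < bs) (hη' : ∀ u, SeqBox γ u → |B u - B' u| ≤ η₀) (hη'' : ∀ u, SeqBox γ u → |B u - B'' u| ≤ η₀)
    (hδ : ∀ u, SeqBox γ u → |B' u - B'' u| ≤ δ)
    (hg₁ : 0 < g₁) (h2g₁ : 2 * g₁ ≤ γ)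
    (hs1 : 4 * Cm * g₁ ≤ bs * (1 - θ))
    (hs2 : g₁ ^ 2 * (1 / gs ^ 2 + Cm * γ / (1 - θ) ^ 2 + (2 * Cm / ((1 - θ) * bs)) ^ 2) ≤ 3 / 4)
    (hs4 : 64 * Cm * g₁ ^ 3 ≤ (1 - θ) ^ 2)
    (he : 0 < e)
    (hs1e : 4 * Cm * e ≤ (bs - 4 * η₀) / 4 * (1 - θ))
    (hs2e : e ^ 2 * (1 / g₁ ^ 2 + Cm * γ / (1 - θ) ^ 2 + (2 * Cm / ((1 - θ) * ((bs - 4 * η₀) / 4))) ^ 2) ≤ 3 / 4)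
    (hs6e : Cm * (8 * e ^ 3 + 16 * e / ((bs - 4 * η₀) / 4)) ≤ (1 - θ) ^ 2 / 4)
    (hhs' : SeqBox γ h') (hhf' : MemFlow B' e h') (hhs'' : SeqBox γ h'') (hhf'' : MemFlow B'' e h'') (m : ℕ) :
    |h' m - h'' m| ≤ 32 / 3 * e * (e ^ 2 + 1 / ((bs - 4 * η₀) / 4)) * δ := by
  have hus : SeqBox γ (fun _ : ℕ => g₁) := fun _ => ⟨hg₁, by linarith⟩
  have henv : ∀ q : ℕ, (fun _ : ℕ => g₁) q ≤ 2 * g₁ := fun _ => by simp only; linarith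
  have hb1 : 0 < (bs - 4 * η₀) / 4 := by linarith
  have h2g0 : 0 < 2 * g₁ := by positivity
  have e4 : 1 / (2 * g₁) ^ 2 = 1 / (4 * g₁ ^ 2) := by ring
  -- part 19: the perturbed functionals' own AF solutions from the reference pin g₁
  obtain ⟨k', hks', hkf', hkprof', -⟩ :=
    exists_memFlow_of_close hB hB' hCm hθ0 hθ1 hbs hta hts htf hprof hη' hη4 hg₁ h2g₁ hus henv hs1 hs2 hs4
  obtain ⟨k'', hks'', hkf'', hkprof'', -⟩ :=
    exists_memFlow_of_close hB hB'' hCm hθ0 hθ1 hbs hta hts htf hprof hη'' hη4 hg₁ h2g₁ hus henv hs1 hs2 hs4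
  have hkref' : ∀ q : ℕ, 1 / (2 * g₁) ^ 2 + (bs - 4 * η₀) / 4 * (q : ℝ) ≤ 1 / (k' q) ^ 2 := fun q => by rw [e4]; exact hkprof' q
  have hkref'' : ∀ q : ℕ, 1 / (2 * g₁) ^ 2 + (bs - 4 * η₀) / 4 * (q : ℝ) ≤ 1 / (k'' q) ^ 2 := fun q => by rw [e4]; exact hkprof'' q
  -- part 10: the GIVEN solutions carry the quarter profile from 2e at rate β₁ (references k′, k″)
  have hPh' := invSq_lower_of_reference_flow hB' hCm hθ0 hθ1 hb1 h2g0 hks' hkf' hkref' hhs' hhf' hs1e hs2e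
  have hPh'' := invSq_lower_of_reference_flow hB'' hCm hθ0 hθ1 hb1 h2g0 hks'' hkf'' hkref'' hhs'' hhf'' hs1e hs2e
  -- part 16: the functional law with B′ as the profiled functional
  exact abs_sub_le_of_functional_close hB' hCm hθ0 hθ1 hb1 he hδ hhs' hhs'' hhf' hhf'' hPh' hPh'' hs6e m

/-! ## §28 On the carrier: around the limit functional of one Setting with Theorem 2 AS TYPED -/

variable {S : Setting}

/-- **THE SOLUTION OPERATOR IS LIPSCHITZ NEAR `betaInf S.β` — FROM THEOREM 2 AS TYPED FOR ONE SETTING.**  `Theorem2Statement S hL` (a HYPOTHESIS), the binder `hrg` on ]0, γ_u],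
NE4 `ScaleShiftRate c θ γ_u S.β`, `HistLipschitz Λ γ_u S.β` with `FadingMemory C θ Λ` (0 < θ < 1, C ≥ 0, c ≥ 0) ⟹ for every torus exponent m there are η₀ > 0, g₁₆ > 0 and K ≥ 0
such that for ANY two functionals B′, B″ with `MemoryProfile C θ γ_u`, both within η₀ of `betaInf S.β` on the box and δ-close to each other there, every pin g ∈ ]0, g₁₆] and
ANY box solutions h′ of `MemFlow B′ g ·`, h″ of `MemFlow B″ g ·`: **`|h′(m′) − h″(m′)| ≤ K·δ` at every physical scale m′** (η₀ = b∕8, β₁ = b∕8, K = (32∕3)g₁₆(g₁₆² + 8∕b) from the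
reference's rate b).  With part 20 (`∃!` from every small pin) this is the local Lipschitz continuity of the solution operator on the open ball of limit functionals.
[cite: Balaban1987RG1, Thm 2 (0.31) p.259 with (0.20) p.256 and §5 p.298] -/
theorem solution_lipschitz_on_ball_of_typedTheorem2 {hL : Odd S.L ∧ 1 < S.L} (h : Theorem2Statement S hL)
    {γu θ C c : ℝ} {Λ : ℕ → ℕ → ℝ} (hγu : 0 < γu)
    (hrg : ∀ P : B12.RunParams, Step.InInterval γu P.K (S.cpl P) → RGEqH P.K S.β (S.cpl P))
    (hS : ScaleShiftRate c θ γu S.β) (hL' : HistLipschitz Λ γu S.β) (hΛ : FadingMemory C θ Λ)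
    (hθ0 : 0 < θ) (hθ1 : θ < 1) (hC : 0 ≤ C) (hc : 0 ≤ c) (m : ℕ) :
    ∃ η₀ g₁₆ K : ℝ, 0 < η₀ ∧ 0 < g₁₆ ∧ 0 ≤ K ∧ ∀ (B' B'' : (ℕ → ℝ) → ℝ) (δ : ℝ), MemoryProfile C θ γu B' → MemoryProfile C θ γu B'' →
      (∀ u : ℕ → ℝ, SeqBox γu u → |betaInf S.β u - B' u| ≤ η₀) → (∀ u : ℕ → ℝ, SeqBox γu u → |betaInf S.β u - B'' u| ≤ η₀) →
      (∀ u : ℕ → ℝ, SeqBox γu u → |B' u - B'' u| ≤ δ) →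
      ∀ (e : ℝ) (h' h'' : ℕ → ℝ), 0 < e → e ≤ g₁₆ → SeqBox γu h' → MemFlow B' e h' → SeqBox γu h'' → MemFlow B'' e h'' →
      ∀ m' : ℕ, |h' m' - h'' m'| ≤ K * δ := by
  have h1θ : 0 < 1 - θ := by linarith
  have hB := memoryProfile_betaInf hS hL' hΛ hθ0.le hθ1
  obtain ⟨gr, b, -, -, t, hgr, hb, -, -, htbox, htflow, hprof, -, -⟩ := reference_of_typedTheorem2 h hγu hrg hS hL' hΛ hθ0 hθ1 hC hc m
  have h2gr : 0 < 2 * gr := by positivity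
  obtain ⟨e₀, he₀, hthr⟩ := flow_threshold_exists (1 / gr ^ 2 + C * γu / (1 - θ) ^ 2 + (2 * C / ((1 - θ) * b)) ^ 2) hC hθ1 hb
  -- the reference pin g₁ for the perturbed functionals
  set g₁ : ℝ := min e₀ (γu / 2) with hg₁
  have hg₁0 : 0 < g₁ := lt_min he₀ (by positivity)
  obtain ⟨hs1, hs2, hs4⟩ := hthr g₁ hg₁0 (min_le_left _ _)
  have h2g₁ : 2 * g₁ ≤ γu := by linarith [min_le_right e₀ (γu / 2)]
  -- η₀ = b∕8, so β₁ = (b − 4η₀)∕4 = b∕8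
  have hb8 : 0 < b / 8 := by positivity
  have hβ₁ : (b - 4 * (b / 8)) / 4 = b / 8 := by ring
  obtain ⟨e₁, he₁, hthr'⟩ := flow_threshold_exists (1 / g₁ ^ 2 + C * γu / (1 - θ) ^ 2 + (2 * C / ((1 - θ) * (b / 8))) ^ 2) hC hθ1 hb8
  -- the kernel smallness `C(8e³ + 16e∕(b∕8)) ≤ (1−θ)²∕4` below e₂
  set e₂ : ℝ := min 1 ((1 - θ) ^ 2 / (4 * (C * (8 + 16 / (b / 8))) + 1)) with he₂
  have he₂0 : 0 < e₂ := lt_min one_pos (by positivity)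
  have hs6 : ∀ e : ℝ, 0 < e → e ≤ e₂ → C * (8 * e ^ 3 + 16 * e / (b / 8)) ≤ (1 - θ) ^ 2 / 4 := by
    intro e he hle
    have hle1 : e ≤ 1 := hle.trans (min_le_left _ _)
    have hle' : e ≤ (1 - θ) ^ 2 / (4 * (C * (8 + 16 / (b / 8))) + 1) := hle.trans (min_le_right _ _)
    rw [le_div_iff₀ (by positivity)] at hle'
    have he3 : e ^ 3 ≤ e := by nlinarith [mul_le_mul hle1 hle1 he.le zero_le_one]
    have hK : 0 ≤ C * (8 + 16 / (b / 8)) := by positivity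
    calc C * (8 * e ^ 3 + 16 * e / (b / 8)) ≤ C * (8 * e + 16 * e / (b / 8)) := by gcongr
      _ = e * (C * (8 + 16 / (b / 8))) := by ring
      _ ≤ (1 - θ) ^ 2 / 4 := by nlinarith
  set g₁₆ : ℝ := min e₁ (min (γu / 2) e₂) with hg₁₆
  have hg₁₆0 : 0 < g₁₆ := lt_min he₁ (lt_min (by positivity) he₂0)
  refine ⟨b / 8, g₁₆, 32 / 3 * g₁₆ * (g₁₆ ^ 2 + 1 / (b / 8)), hb8, hg₁₆0, by positivity,
    fun B' B'' δ hB' hB'' hη' hη'' hδ e h' h'' he hle hhs' hhf' hhs'' hhf'' m' => ?_⟩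
  have hη4 : 4 * (b / 8) < b := by linarith
  obtain ⟨hs1', hs2', -⟩ := hthr' e he (hle.trans (min_le_left _ _))
  have hs6e := hs6 e he (hle.trans ((min_le_right _ _).trans (min_le_right _ _)))
  have hs1e : 4 * C * e ≤ (b - 4 * (b / 8)) / 4 * (1 - θ) := by rw [hβ₁]; exact hs1'
  have hs2e : e ^ 2 * (1 / g₁ ^ 2 + C * γu / (1 - θ) ^ 2 + (2 * C / ((1 - θ) * ((b - 4 * (b / 8)) / 4))) ^ 2) ≤ 3 / 4 := by rw [hβ₁]; exact hs2'
  have hs6e' : C * (8 * e ^ 3 + 16 * e / ((b - 4 * (b / 8)) / 4)) ≤ (1 - θ) ^ 2 / 4 := by rw [hβ₁]; exact hs6e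
  have hδ0 : 0 ≤ δ := (abs_nonneg _).trans (hδ t htbox)
  have hk := abs_sub_le_on_ball hB hB' hB'' hC hθ0.le hθ1 hb h2gr htbox htflow hprof hη4 hη' hη'' hδ hg₁0 h2g₁ hs1 hs2 hs4
    he hs1e hs2e hs6e' hhs' hhf' hhs'' hhf'' m'
  rw [hβ₁] at hk
  have hg0 : 0 ≤ g₁₆ := hg₁₆0.le
  clear_value g₁₆
  have hmono : 32 / 3 * e * (e ^ 2 + 1 / (b / 8)) ≤ 32 / 3 * g₁₆ * (g₁₆ ^ 2 + 1 / (b / 8)) := by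
    have h1 : e ^ 2 ≤ g₁₆ ^ 2 := pow_le_pow_left₀ he.le hle 2
    have h2 : 0 ≤ e ^ 2 + 1 / (b / 8) := by positivity
    calc 32 / 3 * e * (e ^ 2 + 1 / (b / 8)) ≤ 32 / 3 * g₁₆ * (e ^ 2 + 1 / (b / 8)) :=
          mul_le_mul_of_nonneg_right (mul_le_mul_of_nonneg_left hle (by norm_num)) h2
      _ ≤ 32 / 3 * g₁₆ * (g₁₆ ^ 2 + 1 / (b / 8)) :=
          mul_le_mul_of_nonneg_left (add_le_add h1 le_rfl) (mul_nonneg (by norm_num) hg0)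
  exact hk.trans (mul_le_mul_of_nonneg_right hmono hδ0)

end

end Summit.QuantumFields.BalabanUV.Beta.EriceFlowEnclosureB12AsPrintedHistoryContagionShiftFlowPicardOpenLipschitz
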